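import Literature.Barriers.Schanuel.PeriodConjectureOverQbarScope
import Literature.Barriers.Schanuel.NesterenkoModularScope
import Literature.NumberTheory.Transcendental.LindemannWeierstrassProofs
import HarnessLib

/-!
# Fresán's expectation `e^α ∉ \overline{ℚ(𝒫)}` contains the algebraic independence of `e` and `π`

`Literature/Barriers/Schanuel/PeriodConjectureOverQbarScopeProofs.lean` — companion to the
barrier file `PeriodConjectureOverQbarScope.lean`, recording in the kernel why its named
conjecture `Literature.Barriers.Schanuel.ExpTranscendentalOverPeriodField` (Fresán: "On s'attend
même à ce que les nombres `e^α` soient transcendants sur le corps engendré par toutes les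
périodes usuelles" [Fresan2024, Exemple 2.9, p. 26] — an EXPECTATION, printed as such, not a
theorem) cannot be discharged by a `_holds` theorem from the literature: together with the
printed theorem "`π` is a period" (`π = ∬_{x²+y²≤1} dx dy`, Kontsevich–Zagier §1.1; tree fact
`Literature.NumberTheory.Transcendental.KZPeriods.isPeriod_pi`) it implies the algebraic
independence of `e` and `π` over `ℚ`, the tree's registered OPEN statement
`Literature.NumberTheory.Transcendental.ExpOnePiAlgebraicIndependent` (periods.S15, "considered
out of reach"). The barrier file already proves that it implies the Kontsevich–Zagier conjecture
`e ∉ 𝒫` (`expOneNotPeriod_of_expTranscendentalOverPeriodField`).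

Proof: `π ∈ 𝒫` gives `ℚ[π] ⊆ ℚ(𝒫)`, so `e = e¹` transcendental over `ℚ(𝒫)` is transcendental
over `ℚ[π]` (`Transcendental.of_ringHom_of_comp_eq` along the inclusion); `π` is transcendental
(Lindemann, DISCHARGED in the tree: `Literature.NumberTheory.Transcendental.transcendental_pi_holds`),
so `(e, π)` is algebraically independent in `ℂ` (`AlgebraicIndependent.option_iff_transcendental`),
hence in `ℝ` (`algebraicIndependent_real_of_complex`).

Nothing here asserts the conjecture; the statement of `ExpTranscendentalOverPeriodField` is
unchanged and faithful to the source (checked on the page, 2026-08-15).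

## References

* [Fresan2024] J. Fresán, *Une introduction aux périodes*, Journées X-UPS 2019 (publ. 2024),
  Exemple 2.9, pp. 25–26.
* [KontsevichZagier2001] M. Kontsevich, D. Zagier, *Periods* (2001), §1.1.
* [BaysKirby2018ANT] M. Bays, J. Kirby, *Pseudo-exponential maps, variants, and quasiminimality*,
  Algebra Number Theory 12 (2018), §1 ("even the very simple consequence that the numbers e and
  π are algebraically independent is unknown").
-/

noncomputable section

open Complex

namespace Literature.Barriers.Schanuel

/-- Under Fresán's expectation, and given that `π` is a period (`KZPeriods.isPeriod_pi`,
Kontsevich–Zagier §1.1), `e` is transcendental over the subalgebra `ℚ[π] ⊆ ℚ(𝒫)` of `ℂ`.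
PROVED (bookkeeping towards `expOnePiAlgebraicIndependent_of_expTranscendentalOverPeriodField`).
[cite: Fresan2024, Exemple 2.9 (p. 26)] -/
theorem transcendental_adjoin_pi_exp_one (h : ExpTranscendentalOverPeriodField)
    (hπ : Literature.NumberTheory.Transcendental.KZPeriods.isPeriod_pi) :
    Transcendental (Algebra.adjoin ℚ (Set.range ![(Real.pi : ℂ)])) (cexp 1) := by
  set F : IntermediateField ℚ ℂ :=
    IntermediateField.adjoin ℚ Literature.NumberTheory.Transcendental.periods with hF
  set S₀ : Subalgebra ℚ ℂ := Algebra.adjoin ℚ (Set.range ![(Real.pi : ℂ)]) with hS₀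
  have hle : S₀ ≤ F.toSubalgebra := by
    rw [hS₀, Algebra.adjoin_le_iff]
    rintro _ ⟨i, rfl⟩
    have hi : (![(Real.pi : ℂ)] i) = (Real.pi : ℂ) := by
      fin_cases i; rfl
    rw [hi]
    exact IntermediateField.subset_adjoin ℚ _ hπ
  have he : Transcendental F (cexp 1) := h 1 isAlgebraic_one one_ne_zero
  let f : S₀ →+* F :=
    { toFun := fun x => ⟨x.1, hle x.2⟩
      map_one' := rfl
      map_mul' := fun _ _ => rfl
      map_zero' := rfl
      map_add' := fun _ _ => rfl }
  have hf : Function.Injective f := by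
    intro a b hab
    apply Subtype.ext
    have hab' := congrArg Subtype.val hab
    exact hab'
  exact Transcendental.of_ringHom_of_comp_eq f (RingHom.id ℂ) (a := cexp 1) he hf
    (RingHom.ext fun _ => rfl)

/-- **Fresán's expectation contains the algebraic independence of `e` and `π`.** If `e^α` is
transcendental over the field `ℚ(𝒫)` generated by the Kontsevich–Zagier periods for every
non-zero algebraic `α` (`ExpTranscendentalOverPeriodField`, "On s'attend même à ce que les nombres
`e^α` soient transcendants sur le corps engendré par toutes les périodes usuelles"), then — `π`
being a period (`KZPeriods.isPeriod_pi`) and transcendental (Lindemann,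
`Literature.NumberTheory.Transcendental.transcendental_pi_holds`) — `e` and `π` are algebraically
independent over `ℚ`: the tree's registered open statement
`Literature.NumberTheory.Transcendental.ExpOnePiAlgebraicIndependent` (periods.S15). PROVED; it
records that `ExpTranscendentalOverPeriodField` is an open conjecture at least as strong as
periods.S15, so no `ExpTranscendentalOverPeriodField_holds` is to be expected.
[cite: Fresan2024, Exemple 2.9 (p. 26)] [cite: BaysKirby2018ANT, §1 (Introduction)] -/
theorem expOnePiAlgebraicIndependent_of_expTranscendentalOverPeriodField
    (h : ExpTranscendentalOverPeriodField)
    (hπ : Literature.NumberTheory.Transcendental.KZPeriods.isPeriod_pi) :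
    Literature.NumberTheory.Transcendental.ExpOnePiAlgebraicIndependent := by
  -- `π ∈ ℂ` is transcendental over `ℚ` (Lindemann, discharged in the tree), i.e. `![π]` is an
  -- algebraically independent family
  have hπt : Transcendental ℚ (Real.pi : ℂ) := fun hc =>
    Literature.NumberTheory.Transcendental.transcendental_pi_holds
      ((isAlgebraic_algebraMap_iff (algebraMap ℝ ℂ).injective).mp hc)
  have hind : AlgebraicIndependent ℚ ![(Real.pi : ℂ)] :=
    algebraicIndependent_iff_transcendental.mpr hπt
  -- adjoin `e`, transcendental over `ℚ[π]`
  have hopt := (hind.option_iff_transcendental (cexp 1)).mpr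
    (transcendental_adjoin_pi_exp_one h hπ)
  -- reindex `Option (Fin 1) ≃ Fin 2` and descend from `ℂ` to `ℝ`
  have hfun : ((fun o : Option (Fin 1) => o.elim (cexp 1) ![(Real.pi : ℂ)]) ∘
      (![none, some 0] : Fin 2 → Option (Fin 1))) =
      fun i => ((![Real.exp 1, Real.pi] i : ℝ) : ℂ) := by
    funext i
    fin_cases i <;> simp [Complex.ofReal_exp]
  have hinj : Function.Injective (![none, some 0] : Fin 2 → Option (Fin 1)) := by decide
  have hC : AlgebraicIndependent ℚ (fun i => ((![Real.exp 1, Real.pi] i : ℝ) : ℂ)) := by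
    have hcomp := hopt.comp _ hinj
    rw [hfun] at hcomp
    exact hcomp
  exact algebraicIndependent_real_of_complex _ hC

end Literature.Barriers.Schanuel
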